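import Literature.AlgebraicGeometry.Frobenioids.ArchimedeanQuotientLiftingAngular
import HarnessLib

/-!
# Frobenioids II, Proposition 3.5 (i) REPAIRED for `N ⊆ A` (linear isometries) — statement + proof

Mochizuki, *The geometry of Frobenioids II: poly-Frobenioids*, Kyushu J. Math. **62** (2008) 401–460,
§3, Proposition 3.5 (i), kurims p. 34 [cite: MochizukiFrdII2008, Prop 3.5 (i) p.34], for `H = N` "the
subcategory determined by the linear morphisms" of `A` ([FrdII] Ex. 3.3 (iii)), with the terminology of
`C` applied via `N → C` (abc-iut-L1-t9's instance shape `Prop35i_N`). Companion of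
`ArchimedeanQuotientLifting{,Proofs,Angular}.lean`: every arrow produced by the lift has Frobenius degree
`1`, so the `A`-construction lies in `N`; the descended arrow of an `N`-arrow is linear since degrees
multiply (`PreFrobenioid.isLinear_factors`), and the monomorphism argument is re-run with LINEAR isometric
test arrows (`mono_snd_of_mono_linear`, adapted from `QuotientLift.mono_snd_of_mono`).
* `ArchFrd.Prop35iR_N π` — the repaired statement; **`prop35iR_N_holds : Prop35iR_N π`** for every
  functor `π : D → D₀`.
Nothing here bears on [IUTchIII] Cor. 3.12; typed ≠ proved except where a `theorem` says so.
-/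

namespace Literature.AlgebraicGeometry.Frobenioids

open CategoryTheory
open scoped Pointwise

noncomputable section

universe v u

namespace ArchFrd

variable {D : Type u} [Category.{v} D] (π : D ⥤ D0)

/-- **Prop. 3.5 (i) REPAIRED for `H = N`** (instance shape of `ArchFrd.Prop35i_N`, plus Galois saturation).
[cite: MochizukiFrdII2008, Prop 3.5 (i) p.34] -/
def Prop35iR_N : Prop := Prop35iR π (baseRC π) (C.toElem π) (N.toC π)

namespace QuotientLiftN

variable (Q : ArchFrd.N π) {BD : D} (fD : BD ⟶ Q.obj.obj.snd) (GD : Subgroup (Aut BD))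

/-! ### Monomorphisms for linear isometric test arrows -/

/-- An arrow `ζ : B → B′` of `C` under the lift with `ζ ≫ φ' = liftMor` that is a monomorphism for LINEAR
ISOMETRIC test arrows (e.g. a monomorphism of `N`) projects to a monomorphism `ζ_D` of `D` (adapted from
`QuotientLift.mono_snd_of_mono`: its test arrows `(π hᵢ, 1, 1)` are linear isometries).
[cite: MochizukiFrdII2008, Prop 3.5 (i) p.34] -/
theorem mono_snd_of_mono_linear (A : C π) {BD : D} (fD : BD ⟶ A.snd) {A' : C π}
    (ζ : QuotientLift.liftObj π A fD ⟶ A') (φ' : A' ⟶ A) (hfac : ζ ≫ φ' = QuotientLift.liftMor π A fD)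
    (hmono : ∀ ⦃T : C π⦄ (t₁ t₂ : T ⟶ QuotientLift.liftObj π A fD),
      PreFrobenioid.IsIsometry (C.toElem π) t₁ → PreFrobenioid.IsIsometry (C.toElem π) t₂ →
      C0.degFr t₁.fst = 1 → C0.degFr t₂.fst = 1 → t₁ ≫ ζ = t₂ ≫ ζ → t₁ = t₂) :
    Mono ζ.snd := by
  refine ⟨fun {Z} h₁ h₂ heq => ?_⟩
  change Z ⟶ BD at h₁ h₂
  have hπ : π.map h₁ ≫ π.map ζ.snd = π.map h₂ ≫ π.map ζ.snd := by
    rw [← π.map_comp, heq, π.map_comp]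
  obtain ⟨R₁, hR₁c, hR₁t, -, hR₁i⟩ := exists_pulledRegion (QuotientLift.liftC0 π A fD) (π.map h₁)
  have hR₁c2 : R₁.carrier = C0.pullRegion (QuotientLift.liftC0 π A fD) (π.map h₂) := by
    by_cases hθ : π.map h₁ = π.map h₂
    · rw [hR₁c, hθ]
    · have hreal := QuotientLift.isReal_of_ne π A fD ζ φ' (π.map h₁) (π.map h₂) hθ hπ
      have hiso : (QuotientLift.liftC0 π A fD).region.IsIsotropic :=
        (QuotientLift.liftRegion_spec π A fD).2.2.2 (C0.isNaivelyIsotropic_of_isRealObj hreal.2)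
      rw [hR₁c]
      unfold C0.pullRegion
      rw [C0.image_galAct_of_isIsotropic hiso, C0.image_galAct_of_isIsotropic hiso]
  let W₁ : C0 := ⟨π.obj Z, R₁, fun h => hR₁i
      ((QuotientLift.liftC0 π A fD).isIsotropic_of_isReal (UnitStab.D0.isReal_of_hom_real (π.map h₁) h))⟩
  let T : C π := ⟨W₁, Z, Iso.refl _⟩
  let t : ∀ (θ : π.obj Z ⟶ π.obj BD) (_ : R₁.carrier ⊆ C0.pullRegion (QuotientLift.liftC0 π A fD) θ)
      (h : Z ⟶ BD) (_ : θ ≫ 𝟙 _ = 𝟙 _ ≫ π.map h), T ⟶ QuotientLift.liftObj π A fD :=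
    fun θ hθ h hw =>
      ⟨{ base := θ, degFr := 1, scalar := 1, scalar_mem := one_mem _,
         mapsTo := by rw [PNat.one_coe, pow_one, one_smul]; exact hθ }, h, hw⟩
  have hiso : ∀ θ hθ h hw, PreFrobenioid.IsIsometry (C.toElem π) (t θ hθ h hw) := by
    intro θ hθ h hw
    rw [PreFrobenioid.isIsometry_fiberProduct_iff, A0.isIsometry_iff_norm_mul_tip_pow]
    change ‖((1 : ℂˣ) : ℂ)‖ * (R₁.tip : ℝ) ^ ((1 : ℕ+) : ℕ) = ((QuotientLift.liftRegion π A fD).tip : ℝ)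
    rw [Units.val_one, norm_one, one_mul, PNat.one_coe, pow_one, hR₁t]
  have hw₁ : π.map h₁ ≫ 𝟙 _ = 𝟙 _ ≫ π.map h₁ := by rw [Category.comp_id, Category.id_comp]
  have hw₂ : π.map h₂ ≫ 𝟙 _ = 𝟙 _ ≫ π.map h₂ := by rw [Category.comp_id, Category.id_comp]
  have ht : t (π.map h₁) hR₁c.le h₁ hw₁ ≫ ζ = t (π.map h₂) hR₁c2.le h₂ hw₂ ≫ ζ := by
    refine CFP.hom_ext (C0.hom_ext ?_ rfl ?_) heq
    · change π.map h₁ ≫ C0.Base ζ.fst = π.map h₂ ≫ C0.Base ζ.fst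
      by_cases hθ : π.map h₁ = π.map h₂
      · rw [hθ]
      · exact D0.hom_eq_of_isReal (QuotientLift.isReal_of_ne π A fD ζ φ' _ _ hθ hπ).1 _ _
    · change (π.map h₁).act (C0.scalar ζ.fst) * 1 ^ (C0.degFr ζ.fst : ℕ) =
        (π.map h₂).act (C0.scalar ζ.fst) * 1 ^ (C0.degFr ζ.fst : ℕ)
      by_cases hθ : π.map h₁ = π.map h₂
      · rw [hθ]
      · have hcζ := QuotientLift.scalar_fst_mem_real π A fD ζ φ' hfac
          (QuotientLift.isReal_of_ne π A fD ζ φ' _ _ hθ hπ).1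
        unfold D0.Hom.act
        rw [D0.galAct_eq_self_of_mem_scalars_real _ hcζ, D0.galAct_eq_self_of_mem_scalars_real _ hcζ]
  have h12 := hmono _ _ (hiso (π.map h₁) hR₁c.le h₁ hw₁) (hiso (π.map h₂) hR₁c2.le h₂ hw₂) rfl rfl ht
  exact congrArg CFP.Hom.snd h12

/-! ### The lift lies in `N` -/

/-- The object `B` of `N`. [cite: MochizukiFrdII2008, Prop 3.5 (i) p.34] -/
abbrev liftObjN : ArchFrd.N π := ⟨QuotientLiftA.liftObjA π Q.obj fD⟩

/-- **The arrow `B → A` OF `N` lifting `B_D → A_D`** (`liftMor` is a linear isometry).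
[cite: MochizukiFrdII2008, Prop 3.5 (i) p.34] -/
def liftMorN : liftObjN π Q fD ⟶ Q := ⟨QuotientLiftA.liftMorA π Q.obj fD, rfl⟩

/-- Under `N → C`, `liftMorN` is `liftMor`. [cite: MochizukiFrdII2008, Prop 3.5 (i) p.34] -/
@[simp] theorem toC_map_liftMorN : (N.toC π).map (liftMorN π Q fD) = QuotientLift.liftMor π Q.obj.obj fD :=
  rfl

/-- **The lifted automorphism of `B` in `N`.** [cite: MochizukiFrdII2008, Prop 3.5 (i) p.34] -/
def liftAutN (g : Aut BD) (hg : g.hom ≫ fD = fD) : liftObjN π Q fD ≅ liftObjN π Q fD :=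
  CategoryTheory.isoMk (QuotientLiftA.liftAutA π Q.obj fD g hg) rfl rfl

/-- **The group homomorphism `G_D → Aut_N(B)`.** [cite: MochizukiFrdII2008, Prop 3.5 (i) p.34] -/
def liftAutHomN (hGD : ∀ g ∈ GD, g.hom ≫ fD = fD) : GD →* Aut (liftObjN π Q fD) where
  toFun g := liftAutN π Q fD g (hGD g g.2)
  map_one' := by
    apply Iso.ext
    apply WideSubcategory.hom_ext _
    apply WideSubcategory.hom_ext _
    exact CFP.hom_ext (C0.hom_ext (π.map_id BD) rfl rfl) rfl
  map_mul' g h := by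
    apply Iso.ext
    apply WideSubcategory.hom_ext _
    apply WideSubcategory.hom_ext _
    refine CFP.hom_ext (C0.hom_ext (π.map_comp _ _) rfl ?_) rfl
    change (1 : ℂˣ) = (π.map (h : Aut BD).hom).act 1 * 1 ^ ((1 : ℕ+) : ℕ)
    rw [map_one, one_pow, mul_one]

/-- `G_D → Aut_N(B)` is injective. [cite: MochizukiFrdII2008, Prop 3.5 (i) p.34] -/
theorem liftAutHomN_injective (hGD : ∀ g ∈ GD, g.hom ≫ fD = fD) :
    Function.Injective (liftAutHomN π Q fD GD hGD) := by
  intro g h hgh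
  apply Subtype.ext
  apply Iso.ext
  exact congrArg (fun k : Aut (liftObjN π Q fD) => k.hom.hom.hom.snd) hgh

/-! ### Categorical quotient and mono-minimality inside `N` -/

variable {GD}

/-- `B → A` is a categorical quotient of `B` by the lifted group IN `N` (the descended arrow is a linear
isometry: sharpness of `Φ₀` and multiplicativity of degrees). [cite: MochizukiFrdII2008, Prop 3.5 (i) p.34] -/
theorem isCategoricalQuotient_liftMorN (hq : IsCategoricalQuotient GD fD) (hsat : GaloisSaturated π fD GD) :
    IsCategoricalQuotient (liftAutHomN π Q fD GD hq.1).range (liftMorN π Q fD) := by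
  have hC := QuotientLift.isCategoricalQuotient_liftMor π Q.obj.obj fD hq hsat
  refine ⟨?_, ?_⟩
  · rintro γ ⟨g, rfl⟩
    apply WideSubcategory.hom_ext _
    apply WideSubcategory.hom_ext _
    exact QuotientLift.liftAut_hom_comp_liftMor π Q.obj.obj fD (g : Aut BD) (hq.1 g g.2)
  intro X ψ hψ
  have hψC : ∀ γ ∈ (QuotientLift.liftAutHom π Q.obj.obj fD GD hq.1).range,
      γ.hom ≫ ψ.hom.hom = ψ.hom.hom := by
    rintro γ ⟨g, rfl⟩
    exact congrArg (fun k => InducedWideCategory.Hom.hom (InducedWideCategory.Hom.hom k))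
      (hψ (liftAutHomN π Q fD GD hq.1 g) ⟨g, rfl⟩)
  obtain ⟨ψ', hψ', hu⟩ := hC.2 ψ.hom.hom hψC
  have hiso : PreFrobenioid.IsIsometry (C.toElem π) ψ' :=
    (C.isIsometry_of_fac π _ ψ' (hψ' ▸ ψ.hom.property)).2
  have hlin : PreFrobenioid.IsLinear (C.toElem π) ψ' :=
    (PreFrobenioid.isLinear_factors (C.toElem π) (β := QuotientLift.liftMor π Q.obj.obj fD) (α := ψ')
      (hψ' ▸ ψ.property)).1
  exact ⟨⟨⟨ψ', hiso⟩, hlin⟩, WideSubcategory.hom_ext _ (WideSubcategory.hom_ext _ hψ'),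
    fun y hy => WideSubcategory.hom_ext _ (WideSubcategory.hom_ext _ (hu y.hom.hom
      (congrArg (fun k => InducedWideCategory.Hom.hom (InducedWideCategory.Hom.hom k)) hy)))⟩

/-- **`B → A` is a MONO-MINIMAL categorical quotient of `B` by the lifted group IN `N`.**
[cite: MochizukiFrdII2008, Prop 3.5 (i) p.34] -/
theorem isMonoMinimalQuotient_liftMorN (hq : IsMonoMinimalQuotient GD fD)
    (hsat : GaloisSaturated π fD GD) :
    IsMonoMinimalQuotient (liftAutHomN π Q fD GD hq.1.1).range (liftMorN π Q fD) := by
  refine ⟨isCategoricalQuotient_liftMorN π Q fD hq.1 hsat, ?_⟩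
  intro A' ζ φ' hfac hmono hgrp
  obtain ⟨Γ', e', he'⟩ := hgrp
  haveI := hmono
  have hfacC : ζ.hom.hom ≫ φ'.hom.hom = QuotientLift.liftMor π Q.obj.obj fD :=
    congrArg (fun k => InducedWideCategory.Hom.hom (InducedWideCategory.Hom.hom k)) hfac
  have hmonoD : Mono ζ.hom.hom.snd :=
    mono_snd_of_mono_linear π Q.obj.obj fD ζ.hom.hom φ'.hom.hom hfacC (by
      intro T t₁ t₂ h₁ h₂ l₁ l₂ h
      have ht : (⟨⟨t₁, h₁⟩, l₁⟩ : (⟨⟨T⟩⟩ : ArchFrd.N π) ⟶ liftObjN π Q fD) ≫ ζ =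
          (⟨⟨t₂, h₂⟩, l₂⟩ : (⟨⟨T⟩⟩ : ArchFrd.N π) ⟶ liftObjN π Q fD) ≫ ζ :=
        WideSubcategory.hom_ext _ (WideSubcategory.hom_ext _ h)
      exact congrArg (fun k => InducedWideCategory.Hom.hom (InducedWideCategory.Hom.hom k))
        ((cancel_mono ζ).1 ht))
  haveI := hmonoD
  let eΓ := MonoidHom.ofInjective (liftAutHomN_injective π Q fD GD hq.1.1)
  let ρ : GD →* Aut A'.obj.obj.snd :=
    ((CFP.proj₂ (PreFrobenioid.baseFunctor C0.toElem) π).mapAut A'.obj.obj).comp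
      (((N.toC π).mapAut A').comp (Γ'.subtype.comp (e'.toMonoidHom.comp eΓ.toMonoidHom)))
  have hρ : ∀ g : GD, (g : Aut BD).hom ≫ ζ.hom.hom.snd = ζ.hom.hom.snd ≫ (ρ g).hom := fun g =>
    congrArg (fun k => CFP.Hom.snd (InducedWideCategory.Hom.hom (InducedWideCategory.Hom.hom k)))
      (he' (eΓ g))
  have hρinj : Function.Injective ρ := by
    rw [injective_iff_map_eq_one]
    intro g hg1
    have h := hρ g
    rw [hg1] at h
    change (g : Aut BD).hom ≫ ζ.hom.hom.snd = ζ.hom.hom.snd ≫ 𝟙 _ at h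
    rw [Category.comp_id] at h
    have h' : (g : Aut BD).hom = 𝟙 BD :=
      (cancel_mono ζ.hom.hom.snd).1 (h.trans (Category.id_comp _).symm)
    apply Subtype.ext
    apply Iso.ext
    exact h'
  have hisoD : IsIso ζ.hom.hom.snd :=
    hq.2 ζ.hom.hom.snd φ'.hom.hom.snd (congrArg CFP.Hom.snd hfacC) hmonoD
      ⟨ρ.range, MonoidHom.ofInjective hρinj, fun g => hρ g⟩
  haveI := hisoD
  have hbi : PreFrobenioid.IsBaseIso C0.toElem ζ.hom.hom.fst :=
    PreFrobenioid.isBaseIso_fst_of_isIso_snd ζ.hom.hom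
  obtain ⟨hdζ, hdφ⟩ := QuotientLift.degFr_fst_eq_one_of_fac π Q.obj.obj fD ζ.hom.hom φ'.hom.hom hfacC
  have hrel := QuotientLift.scalar_rel_of_fac π Q.obj.obj fD ζ.hom.hom φ'.hom.hom hfacC
  have hbase := QuotientLift.base_rel_of_fac π Q.obj.obj fD ζ.hom.hom φ'.hom.hom hfacC
  have hfull : C0.scalar ζ.hom.hom.fst • (QuotientLift.liftC0 π Q.obj.obj fD).region.carrier =
      C0.pullRegion A'.obj.obj.fst (C0.Base ζ.hom.hom.fst) := by
    have hmζ := ζ.hom.hom.fst.mapsTo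
    change C0.scalar ζ.hom.hom.fst • (QuotientLift.liftC0 π Q.obj.obj fD).region.carrier ^
      (C0.degFr ζ.hom.hom.fst : ℕ) ⊆ C0.pullRegion A'.obj.obj.fst (C0.Base ζ.hom.hom.fst) at hmζ
    rw [hdζ, PNat.one_coe, pow_one] at hmζ
    refine Set.Subset.antisymm hmζ ?_
    have hmφ := φ'.hom.hom.fst.mapsTo
    change C0.scalar φ'.hom.hom.fst • A'.obj.obj.fst.region.carrier ^
      (C0.degFr φ'.hom.hom.fst : ℕ) ⊆ C0.pullRegion Q.obj.obj.fst (C0.Base φ'.hom.hom.fst) at hmφ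
    rw [hdφ, PNat.one_coe, pow_one] at hmφ
    have h1 := Set.image_mono (f := (C0.Base ζ.hom.hom.fst).act) hmφ
    rw [Set.image_smul_distrib] at h1
    change _ ⊆ (C0.Base ζ.hom.hom.fst).act '' C0.pullRegion Q.obj.obj.fst (C0.Base φ'.hom.hom.fst) at h1
    rw [← C0.pullRegion_comp, hbase, ← QuotientLift.liftRegion_carrier] at h1
    have h2 := Set.smul_set_mono (a := C0.scalar ζ.hom.hom.fst) h1
    rw [smul_smul, mul_comm, hrel, one_smul] at h2
    exact h2
  have hpb : PreFrobenioid.IsPullbackMorphism C0.toElem ζ.hom.hom.fst :=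
    (C0.isPullbackMorphism_iff ζ.hom.hom.fst).2 ⟨hdζ, hfull⟩
  haveI : IsIso ζ.hom.hom.fst :=
    (PreFrobenioid.isPullbackMorphism_and_isBaseIso_iff_isIso C0.toElem ζ.hom.hom.fst).mp ⟨hpb, hbi⟩
  haveI : IsIso ζ.hom.hom := CFP.isIso_of_isIso_fst_snd ζ.hom.hom
  exact N.isIso_of_isIso_hom ζ

/-- **Proposition 3.5 (i) for `H = N`, REPAIRED (Galois saturation) — PROVED** over any functor
`π : D → D₀`. [cite: MochizukiFrdII2008, Prop 3.5 (i) p.34] -/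
theorem prop35iR_N_holds : Literature.AlgebraicGeometry.Frobenioids.ArchFrd.Prop35iR_N π := by
  intro _ Q BD fD GD hq hsat
  change BD ⟶ Q.obj.obj.snd at fD
  refine ⟨liftObjN π Q fD, liftMorN π Q fD, Iso.refl _, (liftAutHomN π Q fD GD hq.1.1).range,
    (MonoidHom.ofInjective (liftAutHomN_injective π Q fD GD hq.1.1)).symm,
    QuotientLift.isPullbackMorphism_liftMor π Q.obj.obj fD, (Category.id_comp _).symm, fun γ => ?_,
    isMonoMinimalQuotient_liftMorN π Q fD hq hsat⟩
  have h1 := MonoidHom.apply_ofInjective_symm (liftAutHomN_injective π Q fD GD hq.1.1) γ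
  have h2 : (((MonoidHom.ofInjective (liftAutHomN_injective π Q fD GD hq.1.1)).symm γ : GD) :
      Aut BD).hom = (γ : Aut (liftObjN π Q fD)).hom.hom.hom.snd :=
    congrArg (fun k : Aut (liftObjN π Q fD) => k.hom.hom.hom.snd) h1
  exact (Category.comp_id _).trans (h2.symm.trans (Category.id_comp _).symm)

end QuotientLiftN

/-- **[FrdII] Prop. 3.5 (i) REPAIRED for `H = N` — discharge of the named statement `Prop35iR_N`**
(alias of `QuotientLiftN.prop35iR_N_holds`). [cite: MochizukiFrdII2008, Prop 3.5 (i) p.34] -/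
theorem Prop35iR_N_holds : Prop35iR_N π := QuotientLiftN.prop35iR_N_holds π

end ArchFrd

end

end Literature.AlgebraicGeometry.Frobenioids
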